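import Literature.AnabelianGeometry.EtaleTheta.Setting
import Mathlib.Data.ZMod.Basic
import HarnessLib

/-!
# [EtTh] §1: Prop. 1.1 (Theta Action of the Tempered Fundamental Group) and Lem. 1.2 (Compatibility
# of Theta Trivializations)

Mochizuki, *The étale theta function …*, Publ. RIMS **45** (2009), §1, PRIMS PDF pp. 14–19 (printed
240–245) [cite: MochizukiEtTh2009, Prop 1.1 p.15]. Layer L2 of the abc-iut cell, seat abc-iut-L2-t1.

These two items are the CONSTRUCTION route to the étale theta class (Prop. 1.3): line bundles `L_N`
on the formal schemes `Y_N`, `Z_N`, sections `s₁`, `s_N`, the "theta trivializations" `τ_N` of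
`L̈_N` with zero locus the divisor `D_N`, and actions of `Π^tp_X` on the geometric line bundles `V(−)`.
Formal schemes, log structures and line bundles on them have no carrier in the tree
(plan/FOUNDATIONS.md row 14), so — STATEMENTS-FIRST — the objects are carried by an interface
`LineBundleData D` over the root `ThetaSetting` (sections as abstract types with the printed power and
pull-back maps; automorphism groups of the geometric bundles; the relations "action compatible with the
morphism determined by a section" and "compatible at levels `N₂ ∣ N₁`"; scalar action of roots of
unity), each field quoting print, and
the two printed items are `Prop`-valued predicates `Prop11i`, `Prop11ii`, `Lem12` on such data.
Nothing is asserted; typed ≠ proved. What is NOT typed (no carrier even abstractly useful): the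
commutative diagrams of p. 15 and p. 18 as diagrams (their content is the equations below), the
special-fibre/degree computations ("`O_{Ÿ_N}(D_N) ≅ L̈_N`", p. 18), "`Γ(Y_N, O_{Y_N}) = O_{K_N}`" (p. 14).
-/

namespace Literature.AnabelianGeometry.EtaleTheta

namespace ThetaSetting

variable {p : ℕ} [Fact p.Prime] (D : ThetaSetting p)

/-- **Line-bundle data of [EtTh] §1 pp. 14–18** over the theta setting (interface; formal schemes have
no carrier here). Quoted objects: "`L_N` for the line bundle on `Y_N` determined by the constant function
`Z → ℤ` whose value is 1" (p. 14); "a section `s₁ ∈ Γ(Y = Y₁, L₁)` — well-defined up to an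
`O^×_K`-multiple — whose zero locus on `Y` is precisely the divisor of cusps of `Y`. Also, let us fix an
isomorphism of `L_N^{⊗N}` with `L₁|_{Y_N}`" (pp. 14–15); the "geometric line bundles" `V(−)` and actions
of `Π^tp_X` on them (Prop. 1.1 (ii)); "`L̈_N := L_N|_{Ÿ_N} ≅ L_{2N}^{⊗2} ⊗ O_{J̈_N}`" (p. 17); the
"theta trivialization" `τ_N ∈ Γ(Ÿ_N, L̈_N)`, "a section, well-defined up to an `O^×_{J̈_N}`-multiple, whose
zero locus is precisely the divisor `D_N`" (p. 18). [cite: MochizukiEtTh2009, §1 p.14] -/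
structure LineBundleData where
  /-- `Γ(Z_N, L₁|_{Z_N})` (`= Γ(Z_N, L_N^{⊗N}|_{Z_N})` via the fixed isomorphism), `N ≥ 1` (p. 15). -/
  SecPow : ℕ+ → Type
  /-- `Γ(Z_N, L_N|_{Z_N})` (p. 15). -/
  Sec : ℕ+ → Type
  /-- "raising to the `N`-th power" `Γ(Z_N, L_N|_{Z_N}) → Γ(Z_N, L_N^{⊗N}|_{Z_N})` (p. 15). -/
  powN : ∀ N, Sec N → SecPow N
  /-- `s₁|_{Z_N} ∈ Γ(Z_N, L₁|_{Z_N})`, the restriction of the section `s₁ ∈ Γ(Y, L₁)` "whose zero locus on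
  `Y` is precisely the divisor of cusps of `Y`" (pp. 14–15). -/
  s₁res : ∀ N, SecPow N
  /-- The group of automorphisms of the geometric line bundle `V(L_N ⊗_{O_{K_N}} O_{J_N})` over
  automorphisms of `Y_N ×_{O_{K_N}} O_{J_N}` — where "actions of `Π^tp_X` on `L_N ⊗ O_{J_N}`" live
  (Prop. 1.1 (ii), p. 15). -/
  AutV : ℕ+ → Type
  [instGroupAutV : ∀ N, Group (AutV N)]
  /-- "compatible with the morphism `Z_N → V(L_N ⊗_{O_{K_N}} O_{J_N})` determined by `s_N`" (p. 15): the
  relation between an action `Π^tp_X → Aut V(…)` and a section `s_N`. -/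
  IsCompatibleWith : ∀ N, (D.PiTemp →* AutV N) → Sec N → Prop
  /-- `Γ(Ÿ_N, L̈_N)` (p. 18). -/
  SecDd : ℕ+ → Type
  /-- "`τ_N` … is a section whose zero locus is equal to `D_N`" (p. 18): the predicate "is a theta
  trivialization" on `Γ(Ÿ_N, L̈_N)` (all such differ by `O^×_{J̈_N}`-multiples). -/
  IsThetaTriv : ∀ N, SecDd N → Prop
  /-- `Γ(Ÿ_{N₁}, L̈_{N₂}|_{Ÿ_{N₁}})` for `N₂ ∣ N₁` — the sections in which "`τ_{N₁}^{⊗N₁/N₂} = τ_{N₂}`"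
  (p. 19) is an equation: `L̈_{N₂}|_{Ÿ_{N₁}} ≅ L̈_{N₁}^{⊗N₁/N₂}` (p. 18). -/
  SecMix : ∀ N₁ N₂ : ℕ+, (N₂ : ℕ) ∣ N₁ → Type
  /-- `τ ↦ τ^{⊗N₁/N₂}` : `Γ(Ÿ_{N₁}, L̈_{N₁}) → Γ(Ÿ_{N₁}, L̈_{N₁}^{⊗N₁/N₂}) = Γ(Ÿ_{N₁}, L̈_{N₂}|_{Ÿ_{N₁}})`
  (p. 18). -/
  powDd : ∀ (N₁ N₂ : ℕ+) (h : (N₂ : ℕ) ∣ N₁), SecDd N₁ → SecMix N₁ N₂ h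
  /-- Pull-back of sections along `Ÿ_{N₁} → Ÿ_{N₂}`: `Γ(Ÿ_{N₂}, L̈_{N₂}) → Γ(Ÿ_{N₁}, L̈_{N₂}|_{Ÿ_{N₁}})`
  ("`Ÿ_M → Y` may be regarded as a subcovering of `Ÿ_N → Y`", p. 18). -/
  pullDd : ∀ (N₁ N₂ : ℕ+) (h : (N₂ : ℕ) ∣ N₁), SecDd N₂ → SecMix N₁ N₂ h
  /-- The group of automorphisms of the pair `(Ÿ_N, V(L̈_N))` in which "actions of `Π^tp_Y` on `Ÿ_N`,
  `V(L̈_N)`" live (Lem. 1.2, p. 19). -/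
  AutVdd : ℕ+ → Type
  [instGroupAutVdd : ∀ N, Group (AutVdd N)]
  /-- "which preserve `τ_N`" (p. 19): the stabiliser relation. -/
  Preserves : ∀ N, AutVdd N → SecDd N → Prop
  /-- Multiplication by `2N`-th roots of unity (`⊆ J̈_N ⊇ K_{2N} ∋ ζ_{2N}`) on `V(L̈_N)` ("differs … by
  multiplication by a `2N`-th root of unity", p. 19), as an injective homomorphism from `ℤ/2Nℤ`; the
  `N`-th roots of unity among them are the squares. -/
  rootAct : ∀ N : ℕ+, Multiplicative (ZMod (2 * N)) →* AutVdd N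
  /-- the roots of unity act faithfully -/
  rootAct_injective : ∀ N, Function.Injective (rootAct N)
  /-- COMPATIBILITY of automorphisms at levels `N₂ ∣ N₁`: the pair commutes with the natural morphisms
  `Ÿ_{N₁} → Ÿ_{N₂}`, `V(L̈_{N₁}) → V(L̈_{N₂})` (the second square of the diagram on p. 18 "consists of the
  natural morphisms, hence commutes") — an equivariance RELATION, not a map (automorphisms of a cover do
  not restrict to a subcover). -/
  AutCompat : ∀ N₁ N₂ : ℕ+, (N₂ : ℕ) ∣ N₁ → AutVdd N₁ → AutVdd N₂ → Prop
  /-- "the action determined by the action of Proposition 1.1, (ii)" of `Π^tp_Y` on `Ÿ_N`, `V(L̈_N)`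
  (p. 19; via the cartesian square `V(L̈_N) → V(L_N)`, p. 17). -/
  actProp11 : ∀ N, D.GtpY →* AutVdd N

attribute [instance] LineBundleData.instGroupAutV LineBundleData.instGroupAutVdd

variable {D}

/-! ### Proposition 1.1 -/

/-- **Prop. 1.1 (i)** (p. 15): "The section `s₁|_{Y_N} ∈ Γ(Y_N, L₁|_{Y_N} ≅ L_N^{⊗N})` admits an `N`-th
root `s_N ∈ Γ(Z_N, L_N|_{Z_N})` over `Z_N`." (The commutative diagram of geometric line bundles that
follows restates this.) [cite: MochizukiEtTh2009, Prop 1.1 (i) p.15] -/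
def Prop11i (L : D.LineBundleData) : Prop :=
  ∀ N, ∃ sN : L.Sec N, L.powN N sN = L.s₁res N

/-- **Prop. 1.1 (ii)** (p. 15): "There is a unique action of `Π^tp_X` on `L_N ⊗_{O_{K_N}} O_{J_N}` … that
is compatible with the morphism `Z_N → V(L_N ⊗_{O_{K_N}} O_{J_N})` determined by `s_N` [hence induces the
identity on `s_N^{⊗N} = s₁|_{Z_N}`]. Moreover, this action of `Π^tp_X` factors through
`Π^tp_X/Π^tp_{Z_N} = Gal(Z_N/X)`, and, in fact, induces a faithful action of `Δ^tp_X/Δ^tp_{Z_N}` on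
`L_N ⊗_{O_{K_N}} O_{J_N}`." Uniqueness is among COMPATIBLE actions; factoring and faithfulness are
properties of that action. [cite: MochizukiEtTh2009, Prop 1.1 (ii) p.15] -/
def Prop11ii (L : D.LineBundleData) : Prop :=
  ∀ N (sN : L.Sec N), L.powN N sN = L.s₁res N →
    ∃ ρ : D.PiTemp →* L.AutV N, L.IsCompatibleWith N ρ sN ∧
      (∀ ρ' : D.PiTemp →* L.AutV N, L.IsCompatibleWith N ρ' sN → ρ' = ρ) ∧
      D.GtpZN N ≤ ρ.ker ∧ ρ.ker ⊓ D.Dtp = D.DtpZN N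

/-! ### Lemma 1.2 -/

/-- **Lem. 1.2 (Compatibility of Theta Trivializations)** (p. 19): "By modifying the various `τ_N` by
suitable `O^×_{J̈_N}`-multiples, one may assume that `τ_{N₁}^{⊗N₁/N₂} = τ_{N₂}`, for all positive integers
`N₁`, `N₂` such that `N₂ | N₁`. In particular, there exists a compatible system [as `N` varies over the
positive integers] of actions of `Π^tp_Y` (respectively, `Π^tp_Ÿ`) on `Ÿ_N`, `V(L̈_N)` which preserve
`τ_N`. Finally, each action of this system differs from the action determined by the action of
Proposition 1.1, (ii), by multiplication by a(n) `2N`-th root of unity (respectively, `N`-th root of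
unity)." The last conjunct is the `Π^tp_Ÿ`-refinement: on `Π^tp_Ÿ ≤ Π^tp_Y` the discrepancy is an
`N`-th root of unity, i.e. a SQUARE of a `2N`-th root. [cite: MochizukiEtTh2009, Lem 1.2 p.19] -/
def Lem12 (L : D.LineBundleData) : Prop :=
  ∃ τ : ∀ N : ℕ+, L.SecDd N,
    (∀ N, L.IsThetaTriv N (τ N)) ∧
    (∀ (N₁ N₂ : ℕ+) (h : (N₂ : ℕ) ∣ N₁), L.powDd N₁ N₂ h (τ N₁) = L.pullDd N₁ N₂ h (τ N₂)) ∧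
    ∃ ρ : ∀ N : ℕ+, D.GtpY →* L.AutVdd N,
      (∀ (N : ℕ+) (g : D.GtpY), L.Preserves N (ρ N g) (τ N)) ∧
      (∀ (N₁ N₂ : ℕ+) (h : (N₂ : ℕ) ∣ N₁) (g : D.GtpY), L.AutCompat N₁ N₂ h (ρ N₁ g) (ρ N₂ g)) ∧
      (∀ (N : ℕ+) (g : D.GtpY), ∃ ζ : Multiplicative (ZMod (2 * N)),
        ρ N g = L.rootAct N ζ * L.actProp11 N g) ∧
      ∀ (N : ℕ+) (g : D.PiTemp) (hg : g ∈ D.GtpYdd), ∃ ζ : Multiplicative (ZMod (2 * N)),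
        ρ N ⟨g, D.GtpYN_le _ ((inf_le_left : D.GtpYddN 1 ≤ D.GtpYN (2 * 1)) hg)⟩ =
          L.rootAct N (ζ * ζ) *
            L.actProp11 N ⟨g, D.GtpYN_le _ ((inf_le_left : D.GtpYddN 1 ≤ D.GtpYN (2 * 1)) hg)⟩

end ThetaSetting

end Literature.AnabelianGeometry.EtaleTheta
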